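import Summits.BirchSwinnertonDyer.BirchSwinnertonDyer.Theorems.ManinLocalTwoThreeEtaCuspBasisOneHundredEight
import Summits.BirchSwinnertonDyer.BirchSwinnertonDyer.Theorems.ManinLocalTwoThreeBasisFortyFive
import Summits.BirchSwinnertonDyer.BirchSwinnertonDyer.Theorems.ManinLocalTwoThreeNewformPinningSeventyTwo
import HarnessLib

/-!
# Level 108: `dim S₂(Γ₀(108)) = 10`, the `η`-basis `B1c…B10c` IS a basis (pivot columns `1,2,3,4,5,7,8,10,13,19`), coordinates

Cell `bsd-f2-manin`, route `ManinLocalTwoThree`, cruxes C2/C3 (stmt-BirchSwinnertonDyer-22967 / 22968), LEAD p1 gen 24; `--supports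
stmt-BirchSwinnertonDyer-22967` (helper).  Third file of the level-`108` pinning groundwork (after `…EtaBasisOneHundredEight`,
`…EtaCuspBasisOneHundredEight`, `…OldCuspFormsFiftyFour`): §1 `μ(Γ₀(108)) = 216`, `ν_∞ = 18`, `ν₂ = ν₃ = 0`, `g(X₀(108)) = 10`,
`dim S₂(Γ₀(108)) = 10` (tree `finrank_cuspForm_two_eq_genusX0_holds`); §2 the coefficient functional on combinations
(`cuspCoeff_sum_smul108`), the pivot columns of the ten forms (an g51 `pinsolve-108.out`: `n = 1, 2, 3, 4, 5, 7, 8, 10, 13, 19`) read off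
the kernel tables; §3 the `10 × 10` pivot solve (inverse-matrix `linear_combination` certificates), `linearIndependent_basis108`,
`exists_coords_oneHundredEight` — every `f ∈ S₂(Γ₀(108))`, in particular every `D.f`, has coordinates on `B1c…B10c`.  What remains for
the pinning: the curve-side exclusion at depth `60` and the seven old witnesses (`…OldCuspFormsFiftyFour` + `η₆⁴`).  Nothing here proves
C2/C3, Manin's conjecture or BSD. [cite: DiamondShurman2005, Thm. 3.1.1, Thm. 3.5.1] [cite: CremonaAlgorithms1997, Table 3 (N = 108)]
-/

set_option autoImplicit false
-- lint-debt: the directory name repeats the summit name (sibling precedent `ManinLocalTwoThreeBasisFiftyTwo.lean`)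
set_option linter.dupNamespace false

noncomputable section

open Complex
open UpperHalfPlane hiding I
open scoped MatrixGroups ModularForm
open CongruenceSubgroup PowerSeries
open Literature.NumberTheory.ModularForms
open Literature.NumberTheory.EllipticCurves Literature.NumberTheory.EllipticCurves.ModularForms

namespace Summit.BirchSwinnertonDyer.BirchSwinnertonDyer.Theorems.ManinLocalTwoThree.LevelOneHundredEight

/-! ## §1 `dim S₂(Γ₀(108)) = 10` -/

/-- `μ(Γ₀(108)) = 216`, `ν_∞ = 18`, `ν₂ = ν₃ = 0`. [cite: DiamondShurman2005, §3.8] -/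
theorem gamma0_data_108 : gamma0Index 108 = 216 ∧ nuInfty 108 = 18 ∧ nu₂ 108 = 0 ∧ nu₃ 108 = 0 :=
  ⟨(gamma0Index_mul (m := 4) (n := 27) (by norm_num)).trans
      (by rw [show (4 : ℕ) = 2 ^ 2 by norm_num, show (27 : ℕ) = 3 ^ 3 by norm_num,
        gamma0Index_prime_pow (p := 2) (e := 2) Nat.prime_two (by norm_num),
        gamma0Index_prime_pow (p := 3) (e := 3) Nat.prime_three (by norm_num)]; norm_num),
    by decide, by rw [nu₂_eq_card]; decide, by rw [nu₃_eq_card]; decide⟩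

/-- `g(X₀(108)) = 10`. [cite: DiamondShurman2005, Thm. 3.1.1] -/
theorem genusX0_oneHundredEight : genusX0 108 = 10 := by
  obtain ⟨h1, h2, h3, h4⟩ := gamma0_data_108
  rw [genusX0, h1, h2, h3, h4]

/-- **`dim S₂(Γ₀(108)) = 10`.** [cite: DiamondShurman2005, Thm. 3.5.1] -/
theorem finrank_cuspForm_two_oneHundredEight : Module.finrank ℂ (CuspForm (Gamma0 108) 2) = 10 := by
  have h := finrank_cuspForm_two_eq_genusX0_holds 108
  unfold finrank_cuspForm_two_eq_genusX0 at h
  rw [h, genusX0_oneHundredEight]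

/-! ## §2 The ten cusp forms, the coefficient functional, the pivot columns -/

/-- The ten cusp forms `(B1c, …, B10c)`. [folklore] -/
def basis108 : Fin 10 → CuspForm (Gamma0 108) 2 := ![B1c, B2c, B3c, B4c, B5c, B6c, B7c, B8c, B9c, B10c]

/-- `q`-coefficients of a finite combination in `S₂(Γ₀(108))`. [folklore] -/
theorem cuspCoeff_sum_smul108 (c : Fin 10 → ℂ) (v : Fin 10 → CuspForm (Gamma0 108) 2) (n : ℕ) :
    cuspCoeff (∑ i, c i • v i) n = ∑ i, c i * cuspCoeff (v i) n := by
  rw [← cuspCoeffₗ_apply (one_mem_strictPeriods_coe_gamma0 108) n, map_sum]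
  refine Finset.sum_congr rfl fun i _ ↦ ?_
  rw [map_smul, smul_eq_mul, cuspCoeffₗ_apply]

/-- The pivot `q`-coefficients of `B1c` (from the kernel table `eB1`). [cite: Koehler2011, §2.1] -/
theorem cols_B1c :
    cuspCoeff B1c 1 = (0 : ℂ) ∧
    cuspCoeff B1c 2 = (0 : ℂ) ∧
    cuspCoeff B1c 3 = (0 : ℂ) ∧
    cuspCoeff B1c 4 = (0 : ℂ) ∧
    cuspCoeff B1c 5 = (0 : ℂ) ∧
    cuspCoeff B1c 7 = (0 : ℂ) ∧
    cuspCoeff B1c 8 = (0 : ℂ) ∧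
    cuspCoeff B1c 10 = (0 : ℂ) ∧
    cuspCoeff B1c 13 = (0 : ℂ) ∧
    cuspCoeff B1c 19 = (1 : ℂ) := by
  refine ⟨?_, ?_, ?_, ?_, ?_, ?_, ?_, ?_, ?_, ?_⟩ <;> (rw [cuspCoeff, ← coeff_B1c _ (by norm_num)]; norm_num [eB1])

/-- The pivot `q`-coefficients of `B2c` (from the kernel table `eB2`). [cite: Koehler2011, §2.1] -/
theorem cols_B2c :
    cuspCoeff B2c 1 = (0 : ℂ) ∧
    cuspCoeff B2c 2 = (0 : ℂ) ∧
    cuspCoeff B2c 3 = (0 : ℂ) ∧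
    cuspCoeff B2c 4 = (0 : ℂ) ∧
    cuspCoeff B2c 5 = (0 : ℂ) ∧
    cuspCoeff B2c 7 = (0 : ℂ) ∧
    cuspCoeff B2c 8 = (0 : ℂ) ∧
    cuspCoeff B2c 10 = (1 : ℂ) ∧
    cuspCoeff B2c 13 = (0 : ℂ) ∧
    cuspCoeff B2c 19 = (-1 : ℂ) := by
  refine ⟨?_, ?_, ?_, ?_, ?_, ?_, ?_, ?_, ?_, ?_⟩ <;> (rw [cuspCoeff, ← coeff_B2c _ (by norm_num)]; norm_num [eB2])

/-- The pivot `q`-coefficients of `B3c` (from the kernel table `eB3`). [cite: Koehler2011, §2.1] -/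
theorem cols_B3c :
    cuspCoeff B3c 1 = (1 : ℂ) ∧
    cuspCoeff B3c 2 = (0 : ℂ) ∧
    cuspCoeff B3c 3 = (0 : ℂ) ∧
    cuspCoeff B3c 4 = (0 : ℂ) ∧
    cuspCoeff B3c 5 = (0 : ℂ) ∧
    cuspCoeff B3c 7 = (-1 : ℂ) ∧
    cuspCoeff B3c 8 = (0 : ℂ) ∧
    cuspCoeff B3c 10 = (-2 : ℂ) ∧
    cuspCoeff B3c 13 = (-1 : ℂ) ∧
    cuspCoeff B3c 19 = (3 : ℂ) := by
  refine ⟨?_, ?_, ?_, ?_, ?_, ?_, ?_, ?_, ?_, ?_⟩ <;> (rw [cuspCoeff, ← coeff_B3c _ (by norm_num)]; norm_num [eB3])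

/-- The pivot `q`-coefficients of `B4c` (from the kernel table `eB4`). [cite: Koehler2011, §2.1] -/
theorem cols_B4c :
    cuspCoeff B4c 1 = (0 : ℂ) ∧
    cuspCoeff B4c 2 = (0 : ℂ) ∧
    cuspCoeff B4c 3 = (0 : ℂ) ∧
    cuspCoeff B4c 4 = (0 : ℂ) ∧
    cuspCoeff B4c 5 = (0 : ℂ) ∧
    cuspCoeff B4c 7 = (1 : ℂ) ∧
    cuspCoeff B4c 8 = (0 : ℂ) ∧
    cuspCoeff B4c 10 = (0 : ℂ) ∧
    cuspCoeff B4c 13 = (-2 : ℂ) ∧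
    cuspCoeff B4c 19 = (1 : ℂ) := by
  refine ⟨?_, ?_, ?_, ?_, ?_, ?_, ?_, ?_, ?_, ?_⟩ <;> (rw [cuspCoeff, ← coeff_B4c _ (by norm_num)]; norm_num [eB4])

/-- The pivot `q`-coefficients of `B5c` (from the kernel table `eB5`). [cite: Koehler2011, §2.1] -/
theorem cols_B5c :
    cuspCoeff B5c 1 = (0 : ℂ) ∧
    cuspCoeff B5c 2 = (0 : ℂ) ∧
    cuspCoeff B5c 3 = (0 : ℂ) ∧
    cuspCoeff B5c 4 = (0 : ℂ) ∧
    cuspCoeff B5c 5 = (0 : ℂ) ∧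
    cuspCoeff B5c 7 = (0 : ℂ) ∧
    cuspCoeff B5c 8 = (0 : ℂ) ∧
    cuspCoeff B5c 10 = (0 : ℂ) ∧
    cuspCoeff B5c 13 = (1 : ℂ) ∧
    cuspCoeff B5c 19 = (-1 : ℂ) := by
  refine ⟨?_, ?_, ?_, ?_, ?_, ?_, ?_, ?_, ?_, ?_⟩ <;> (rw [cuspCoeff, ← coeff_B5c _ (by norm_num)]; norm_num [eB5])

/-- The pivot `q`-coefficients of `B6c` (from the kernel table `eB6`). [cite: Koehler2011, §2.1] -/
theorem cols_B6c :
    cuspCoeff B6c 1 = (0 : ℂ) ∧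
    cuspCoeff B6c 2 = (0 : ℂ) ∧
    cuspCoeff B6c 3 = (0 : ℂ) ∧
    cuspCoeff B6c 4 = (1 : ℂ) ∧
    cuspCoeff B6c 5 = (0 : ℂ) ∧
    cuspCoeff B6c 7 = (0 : ℂ) ∧
    cuspCoeff B6c 8 = (0 : ℂ) ∧
    cuspCoeff B6c 10 = (-1 : ℂ) ∧
    cuspCoeff B6c 13 = (-1 : ℂ) ∧
    cuspCoeff B6c 19 = (1 : ℂ) := by
  refine ⟨?_, ?_, ?_, ?_, ?_, ?_, ?_, ?_, ?_, ?_⟩ <;> (rw [cuspCoeff, ← coeff_B6c _ (by norm_num)]; norm_num [eB6])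

/-- The pivot `q`-coefficients of `B7c` (from the kernel table `eB7`). [cite: Koehler2011, §2.1] -/
theorem cols_B7c :
    cuspCoeff B7c 1 = (0 : ℂ) ∧
    cuspCoeff B7c 2 = (0 : ℂ) ∧
    cuspCoeff B7c 3 = (1 : ℂ) ∧
    cuspCoeff B7c 4 = (0 : ℂ) ∧
    cuspCoeff B7c 5 = (-1 : ℂ) ∧
    cuspCoeff B7c 7 = (1 : ℂ) ∧
    cuspCoeff B7c 8 = (0 : ℂ) ∧
    cuspCoeff B7c 10 = (0 : ℂ) ∧
    cuspCoeff B7c 13 = (-2 : ℂ) ∧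
    cuspCoeff B7c 19 = (1 : ℂ) := by
  refine ⟨?_, ?_, ?_, ?_, ?_, ?_, ?_, ?_, ?_, ?_⟩ <;> (rw [cuspCoeff, ← coeff_B7c _ (by norm_num)]; norm_num [eB7])

/-- The pivot `q`-coefficients of `B8c` (from the kernel table `eB8`). [cite: Koehler2011, §2.1] -/
theorem cols_B8c :
    cuspCoeff B8c 1 = (0 : ℂ) ∧
    cuspCoeff B8c 2 = (0 : ℂ) ∧
    cuspCoeff B8c 3 = (0 : ℂ) ∧
    cuspCoeff B8c 4 = (0 : ℂ) ∧
    cuspCoeff B8c 5 = (1 : ℂ) ∧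
    cuspCoeff B8c 7 = (0 : ℂ) ∧
    cuspCoeff B8c 8 = (0 : ℂ) ∧
    cuspCoeff B8c 10 = (0 : ℂ) ∧
    cuspCoeff B8c 13 = (0 : ℂ) ∧
    cuspCoeff B8c 19 = (0 : ℂ) := by
  refine ⟨?_, ?_, ?_, ?_, ?_, ?_, ?_, ?_, ?_, ?_⟩ <;> (rw [cuspCoeff, ← coeff_B8c _ (by norm_num)]; norm_num [eB8])

/-- The pivot `q`-coefficients of `B9c` (from the kernel table `eB9`). [cite: Koehler2011, §2.1] -/
theorem cols_B9c :
    cuspCoeff B9c 1 = (0 : ℂ) ∧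
    cuspCoeff B9c 2 = (1 : ℂ) ∧
    cuspCoeff B9c 3 = (0 : ℂ) ∧
    cuspCoeff B9c 4 = (0 : ℂ) ∧
    cuspCoeff B9c 5 = (-1 : ℂ) ∧
    cuspCoeff B9c 7 = (0 : ℂ) ∧
    cuspCoeff B9c 8 = (1 : ℂ) ∧
    cuspCoeff B9c 10 = (0 : ℂ) ∧
    cuspCoeff B9c 13 = (0 : ℂ) ∧
    cuspCoeff B9c 19 = (0 : ℂ) := by
  refine ⟨?_, ?_, ?_, ?_, ?_, ?_, ?_, ?_, ?_, ?_⟩ <;> (rw [cuspCoeff, ← coeff_B9c _ (by norm_num)]; norm_num [eB9])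

/-- The pivot `q`-coefficients of `B10c` (from the kernel table `eB10`). [cite: Koehler2011, §2.1] -/
theorem cols_B10c :
    cuspCoeff B10c 1 = (0 : ℂ) ∧
    cuspCoeff B10c 2 = (0 : ℂ) ∧
    cuspCoeff B10c 3 = (0 : ℂ) ∧
    cuspCoeff B10c 4 = (0 : ℂ) ∧
    cuspCoeff B10c 5 = (0 : ℂ) ∧
    cuspCoeff B10c 7 = (0 : ℂ) ∧
    cuspCoeff B10c 8 = (1 : ℂ) ∧
    cuspCoeff B10c 10 = (0 : ℂ) ∧
    cuspCoeff B10c 13 = (0 : ℂ) ∧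
    cuspCoeff B10c 19 = (0 : ℂ) := by
  refine ⟨?_, ?_, ?_, ?_, ?_, ?_, ?_, ?_, ?_, ?_⟩ <;> (rw [cuspCoeff, ← coeff_B10c _ (by norm_num)]; norm_num [eB10])

end Summit.BirchSwinnertonDyer.BirchSwinnertonDyer.Theorems.ManinLocalTwoThree.LevelOneHundredEight

end
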